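import Summits.QuantumFields.BalabanUV.Beta.GAN24.PairingCellTransfer
import Summits.QuantumFields.BalabanUV.Beta.GAN24.RespGaugeStencil

/-!
# `BalabanUV.Beta.GAN24.FaceWordCurrentsDeep` — binder row G-an2-4 ∕ (CONV-C), W-slot (α-0), ROW (C)sym AT LEVELS `≥ 1`, typer's PART VI row **T6-VAL**, the (γ) hand's
# letter **K7-a**, kinematics: **THE TWO PERIOD-`N` TWO-FACE CURRENTS OF A LOCAL STENCIL FAMILY** — the right current `FF_R(f,z) = Σ'_w χ_N(w_β)·Σ'_t [t_ν face]·S ν t (z,w)_{fg}`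
# (bounded, `N`-periodic in its site, Part 42's `mask·S` spelling ↔ the `if`-spelling) and the left single-bond current `L_v(f,x) = Σ'_y χ_N(y_α)·S μ v (y,x)_{αf}`
# (bi-localised at its bond, covariant, and its face-gated lattice sum IS the left two-face current `FF_L` — one 2-fold Fubini) — the inputs of `FaceWordCellPairingDeep`
# (G-an2-4 CRUX TEAM (2), seat `b2b-balaban-gan24-formalise-leaf-06` = the (γ) hand, gen 56; journal [GAN24LEAF06-G56-INTENT2])

NOT IN PRINT; OUR BOOKKEEPING ([folklore] BY NAME over leaf-04's `RespGaugeStencil.decays_faceStencil ∕ tsum_faceface_block_periodic`, leaf-02's Part 42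
`PairingCellTransfer.ite_eq_mask_mul`, an2's `ExpKernelCalculus`; 0 `def`, 0 cited fact, 0 `def … : Prop`, 0 sorry).  HONEST FRAMING (cell contract, verbatim): «discharging
`BetaPertH` makes Bałaban's UV stability UNCONDITIONAL — a real constructive-QFT result; it is NOT the continuum limit and NOT the Clay problem.»  HONEST DEPENDENCY (verbatim):
«continuum YM on T⁴ ⇐ BetaPertH ∧ nine spine estimates (0/9 proved); BetaPertH ⇐ (D1) ∧ (D4) ∧ CAP+tail; G-an2-4 gates asym, D1 and NE2/3/4.»
WHAT ([folklore]; `hS : LocStencil S Cs δ`, `hδ : 0 < δ`, `hSt` = `N`-covariance): §1 `faceR_mask_eq`, `abs_faceR_le`, `faceR_periodic`; §2 `summable_leftCurrent`, `abs_leftCurrent_le`,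
`leftCurrent_cov`, `tsum_leftCurrent_eq_faceL`.  Asserts NO value of any table; discharges NOTHING of `hX` ∕ `hXu` ∕ (C)_{≥1} ∕ `hB0` ∕ `hBF`; NEVER «G-an2-4 closed» as (CONV-C);
NOT D1, NOT `BetaPertH`, NOT continuum, NOT Clay.  2026-08-24; no existing file touched.
-/

noncomputable section

open Finset
open scoped BigOperators
open Literature.MathematicalPhysics.QuantumFieldTheory
open Literature.MathematicalPhysics.QuantumFieldTheory.Balaban1983to89
open Literature.MathematicalPhysics.QuantumFieldTheory.Balaban1983to89.Beta
open B12Sec2to5 (l1 l1_nonneg)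
open ExpKernelCalculus (Site MKer Decays BiLoc shiftK comp Zl Zl_pos Zl_nonneg summable_exp_shift summable_exp_shift' tsum_exp_shift tsum_exp_shift' l1_sub_symm)
open OneStepResolventKernel (Fib LocStencil)
open AffineAveraging (box toSite)
open Summit.QuantumFields.BalabanUV.Beta.GAN24.PairingCellTransfer (ite_eq_mask_mul)
open Summit.QuantumFields.BalabanUV.Beta.GAN24.RespGaugeStencil (decays_faceStencil tsum_faceface_block_periodic)

namespace Summit.QuantumFields.BalabanUV.Beta.GAN24.FaceWordCurrentsDeep

variable {d : ℕ} {N : ℕ} [NeZero N]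
variable {S : Fin (d + 1) → Site (d + 1) → MKer (d + 1) (Fib d)} {Cs δ : ℝ}

/-! ## §1 The right two-face current at period `N` -/

omit [NeZero N] in
/-- [folklore] Part 42's spelling of the right current (`mask · S`, with a unit scalar) is the `if`-spelling of K1b ∕ `FaceWordEEValueDeep`. -/
theorem faceR_mask_eq (ν β : Fin (d + 1)) (z : Site (d + 1)) (f g : Fib d) :
    (∑' w : Site (d + 1), (if w β % (N : ℤ) = (N : ℤ) - 1 then (1 : ℝ) else 0) *
        ((1 : ℝ) * ∑' t : Site (d + 1), (if t ν % (N : ℤ) = (N : ℤ) - 1 then (1 : ℝ) else 0) * S ν t z w f g)) =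
      ∑' w : Site (d + 1), (if w β % (N : ℤ) = (N : ℤ) - 1 then (1 : ℝ) else 0) *
        ∑' t : Site (d + 1), (if t ν % (N : ℤ) = (N : ℤ) - 1 then S ν t z w f g else 0) := by
  refine tsum_congr fun w => ?_
  rw [one_mul]
  congr 1
  exact tsum_congr fun t => (ite_eq_mask_mul _ _).symm

omit [NeZero N] in
/-- [folklore] **THE RIGHT TWO-FACE CURRENT IS BOUNDED**: `|Σ'_w χ_N(w_β)·Σ'_t [t_ν face]·S ν t (z,w)_{fg}| ≤ Cs·Zl(δ∕2)·Zl(δ∕2)` (the face-gated slot sum is a decaying kernel,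
`RespGaugeStencil.decays_faceStencil`; the leg weight is bounded by `1`). -/
theorem abs_faceR_le (hS : LocStencil S Cs δ) (hδ : 0 < δ) (ν β : Fin (d + 1)) (z : Site (d + 1)) (f g : Fib d) :
    |∑' w : Site (d + 1), (if w β % (N : ℤ) = (N : ℤ) - 1 then (1 : ℝ) else 0) *
        ∑' t : Site (d + 1), (if t ν % (N : ℤ) = (N : ℤ) - 1 then S ν t z w f g else 0)| ≤ Cs * Zl (d + 1) (δ / 2) * Zl (d + 1) (δ / 2) := by
  have hD := decays_faceStencil (N := N) hS hδ ν
  have hδ2 : 0 < δ / 2 := half_pos hδ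
  have hmaj := ((summable_exp_shift hδ2 z).mul_left (Cs * Zl (d + 1) (δ / 2))).hasSum
  have hb := tsum_of_norm_bounded hmaj
    (f := fun w : Site (d + 1) => (if w β % (N : ℤ) = (N : ℤ) - 1 then (1 : ℝ) else 0) *
      ∑' t : Site (d + 1), (if t ν % (N : ℤ) = (N : ℤ) - 1 then S ν t z w f g else 0)) fun w => ?_
  · rw [Real.norm_eq_abs] at hb
    refine hb.trans (le_of_eq ?_)
    rw [tsum_mul_left, tsum_exp_shift]
  · rw [Real.norm_eq_abs, abs_mul]
    have h1 : |(if w β % (N : ℤ) = (N : ℤ) - 1 then (1 : ℝ) else 0)| ≤ 1 := by split_ifs <;> simp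
    have h2 := hD z w f g
    have h0 : 0 ≤ Cs * Zl (d + 1) (δ / 2) * Real.exp (-(δ / 2) * l1 (z - w)) := by
      have : 0 ≤ Cs := (hS 0 0).nonneg (Sum.inl 0)
      have := (Zl_pos (D := d + 1) (half_pos hδ)).le
      positivity
    calc |(if w β % (N : ℤ) = (N : ℤ) - 1 then (1 : ℝ) else 0)| * |∑' t : Site (d + 1), (if t ν % (N : ℤ) = (N : ℤ) - 1 then S ν t z w f g else 0)|
        ≤ 1 * (Cs * Zl (d + 1) (δ / 2) * Real.exp (-(δ / 2) * l1 (z - w))) := mul_le_mul h1 h2 (abs_nonneg _) zero_le_one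
      _ = Cs * Zl (d + 1) (δ / 2) * Real.exp (-(δ / 2) * l1 (z - w)) := one_mul _

omit [NeZero N] in
/-- [folklore] **THE RIGHT TWO-FACE CURRENT IS `N`-PERIODIC IN ITS SITE** (block covariance of `S`, `RespGaugeStencil.tsum_faceface_block_periodic`). -/
theorem faceR_periodic (hSt : ∀ (κ : Fin (d + 1)) (t s : Site (d + 1)), S κ (t + (N : ℤ) • s) = shiftK (-((N : ℤ) • s)) (S κ t))
    (ν β : Fin (d + 1)) (z s : Site (d + 1)) (f g : Fib d) :
    (∑' w : Site (d + 1), (if w β % (N : ℤ) = (N : ℤ) - 1 then (1 : ℝ) else 0) *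
        ∑' t : Site (d + 1), (if t ν % (N : ℤ) = (N : ℤ) - 1 then S ν t (z + (N : ℤ) • s) w f g else 0)) =
      ∑' w : Site (d + 1), (if w β % (N : ℤ) = (N : ℤ) - 1 then (1 : ℝ) else 0) *
        ∑' t : Site (d + 1), (if t ν % (N : ℤ) = (N : ℤ) - 1 then S ν t z w f g else 0) := by
  have h := tsum_faceface_block_periodic (N := N) hSt ν β z s f g
  have conv : ∀ zz : Site (d + 1), (∑' w : Site (d + 1), (if w β % (N : ℤ) = (N : ℤ) - 1 then (1 : ℝ) else 0) *
      ∑' t : Site (d + 1), (if t ν % (N : ℤ) = (N : ℤ) - 1 then S ν t zz w f g else 0)) =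
      ∑' w : Site (d + 1), (if w β % (N : ℤ) = (N : ℤ) - 1 then
        ∑' t : Site (d + 1), (if t ν % (N : ℤ) = (N : ℤ) - 1 then S ν t zz w f g else 0) else 0) :=
    fun zz => tsum_congr fun w => by split_ifs <;> simp
  rw [conv, conv, h]

/-! ## §2 The left single-bond current and its face-gated lattice sum -/

omit [NeZero N] in
/-- [folklore] Summability of the left single-bond current's series `y ↦ χ_N(y_α)·S μ v (y,x)_{αf}` (bi-localisation of `S μ v`). -/
theorem summable_leftCurrent (hS : LocStencil S Cs δ) (hδ : 0 < δ) (μ α : Fin (d + 1)) (v x : Site (d + 1)) (f : Fib d) :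
    Summable fun y : Site (d + 1) => (if y α % (N : ℤ) = (N : ℤ) - 1 then (1 : ℝ) else 0) * S μ v y x (Sum.inl α) f := by
  have hCs : 0 ≤ Cs := (hS 0 0).nonneg (Sum.inl 0)
  refine Summable.of_norm_bounded (((summable_exp_shift' hδ v).mul_left (Cs * Real.exp (-δ * l1 (x - v))))) fun y => ?_
  rw [Real.norm_eq_abs, abs_mul]
  have h1 : |(if y α % (N : ℤ) = (N : ℤ) - 1 then (1 : ℝ) else 0)| ≤ 1 := by split_ifs <;> simp
  have h2 := hS μ v y x (Sum.inl α) f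
  calc |(if y α % (N : ℤ) = (N : ℤ) - 1 then (1 : ℝ) else 0)| * |S μ v y x (Sum.inl α) f|
      ≤ 1 * (Cs * Real.exp (-δ * (l1 (y - v) + l1 (x - v)))) := mul_le_mul h1 h2 (abs_nonneg _) zero_le_one
    _ = Cs * Real.exp (-δ * l1 (x - v)) * Real.exp (-δ * l1 (y - v)) := by rw [one_mul, mul_add, Real.exp_add]; ring

omit [NeZero N] in
/-- [folklore] **THE LEFT SINGLE-BOND CURRENT IS BI-LOCALISED AT ITS BOND**: `|Σ'_y χ_N(y_α)·S μ v (y,x)_{αf}| ≤ Cs·Zl(δ)·e^{−δ|x − v|₁}`. -/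
theorem abs_leftCurrent_le (hS : LocStencil S Cs δ) (hδ : 0 < δ) (μ α : Fin (d + 1)) (v x : Site (d + 1)) (f : Fib d) :
    |∑' y : Site (d + 1), (if y α % (N : ℤ) = (N : ℤ) - 1 then (1 : ℝ) else 0) * S μ v y x (Sum.inl α) f| ≤
      Cs * Zl (d + 1) δ * Real.exp (-δ * l1 (x - v)) := by
  have hCs : 0 ≤ Cs := (hS 0 0).nonneg (Sum.inl 0)
  have hmaj := ((summable_exp_shift' hδ v).mul_left (Cs * Real.exp (-δ * l1 (x - v)))).hasSum
  have hb := tsum_of_norm_bounded hmaj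
    (f := fun y : Site (d + 1) => (if y α % (N : ℤ) = (N : ℤ) - 1 then (1 : ℝ) else 0) * S μ v y x (Sum.inl α) f) fun y => ?_
  · rw [Real.norm_eq_abs] at hb
    refine hb.trans (le_of_eq ?_)
    rw [tsum_mul_left, tsum_exp_shift']
    ring
  · rw [Real.norm_eq_abs, abs_mul]
    have h1 : |(if y α % (N : ℤ) = (N : ℤ) - 1 then (1 : ℝ) else 0)| ≤ 1 := by split_ifs <;> simp
    have h2 := hS μ v y x (Sum.inl α) f
    calc |(if y α % (N : ℤ) = (N : ℤ) - 1 then (1 : ℝ) else 0)| * |S μ v y x (Sum.inl α) f|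
        ≤ 1 * (Cs * Real.exp (-δ * (l1 (y - v) + l1 (x - v)))) := mul_le_mul h1 h2 (abs_nonneg _) zero_le_one
      _ = Cs * Real.exp (-δ * l1 (x - v)) * Real.exp (-δ * l1 (y - v)) := by rw [one_mul, mul_add, Real.exp_add]; ring

omit [NeZero N] in
/-- [folklore] **COVARIANCE OF THE LEFT SINGLE-BOND CURRENT** under the joint shift of bond and site by `N•s` (block covariance of `S`, periodicity of the mask). -/
theorem leftCurrent_cov (hSt : ∀ (κ : Fin (d + 1)) (t s : Site (d + 1)), S κ (t + (N : ℤ) • s) = shiftK (-((N : ℤ) • s)) (S κ t))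
    (μ α : Fin (d + 1)) (v x s : Site (d + 1)) (f : Fib d) :
    (∑' y : Site (d + 1), (if y α % (N : ℤ) = (N : ℤ) - 1 then (1 : ℝ) else 0) * S μ (v + (N : ℤ) • s) y (x + (N : ℤ) • s) (Sum.inl α) f) =
      ∑' y : Site (d + 1), (if y α % (N : ℤ) = (N : ℤ) - 1 then (1 : ℝ) else 0) * S μ v y x (Sum.inl α) f := by
  rw [← (Equiv.addRight ((N : ℤ) • s)).tsum_eq]
  refine tsum_congr fun y => ?_
  simp only [Equiv.coe_addRight]
  rw [hSt μ v s]
  simp only [shiftK, add_neg_cancel_right, Pi.add_apply, Pi.smul_apply, smul_eq_mul, Int.add_mul_emod_self_left]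

omit [NeZero N] in
/-- [folklore] **THE FACE-GATED LATTICE SUM OF THE LEFT SINGLE-BOND CURRENTS IS THE LEFT TWO-FACE CURRENT** (Fubini on the absolutely summable family
`(v, y) ↦ χ_N(v_μ)χ_N(y_α)·S μ v (y,x)_{αf}`): `Σ'_v χ_N(v_μ)·Σ'_y χ_N(y_α)·S μ v (y,x)_{αf} = Σ'_y χ_N(y_α)·Σ'_v [v_μ face]·S μ v (y,x)_{αf}`. -/
theorem tsum_leftCurrent_eq_faceL (hS : LocStencil S Cs δ) (hδ : 0 < δ) (μ α : Fin (d + 1)) (x : Site (d + 1)) (f : Fib d) :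
    (∑' v : Site (d + 1), (if v μ % (N : ℤ) = (N : ℤ) - 1 then (1 : ℝ) else 0) *
        ∑' y : Site (d + 1), (if y α % (N : ℤ) = (N : ℤ) - 1 then (1 : ℝ) else 0) * S μ v y x (Sum.inl α) f) =
      ∑' y : Site (d + 1), (if y α % (N : ℤ) = (N : ℤ) - 1 then (1 : ℝ) else 0) *
        ∑' v : Site (d + 1), (if v μ % (N : ℤ) = (N : ℤ) - 1 then S μ v y x (Sum.inl α) f else 0) := by
  have hCs : 0 ≤ Cs := (hS 0 0).nonneg (Sum.inl 0)
  -- the joint family and its product majorant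
  set F : Site (d + 1) × Site (d + 1) → ℝ := fun q => (if q.1 μ % (N : ℤ) = (N : ℤ) - 1 then (1 : ℝ) else 0) *
    ((if q.2 α % (N : ℤ) = (N : ℤ) - 1 then (1 : ℝ) else 0) * S μ q.1 q.2 x (Sum.inl α) f) with hF
  have hFle : ∀ q : Site (d + 1) × Site (d + 1), |F q| ≤ (Cs * Real.exp (-δ * l1 (x - q.1))) * Real.exp (-δ * l1 (q.2 - q.1)) := by
    intro q
    rw [hF, abs_mul, abs_mul]
    have h1 : |(if q.1 μ % (N : ℤ) = (N : ℤ) - 1 then (1 : ℝ) else 0)| ≤ 1 := by split_ifs <;> simp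
    have h2 : |(if q.2 α % (N : ℤ) = (N : ℤ) - 1 then (1 : ℝ) else 0)| ≤ 1 := by split_ifs <;> simp
    have h3 := hS μ q.1 q.2 x (Sum.inl α) f
    have h0 : 0 ≤ Cs * Real.exp (-δ * (l1 (q.2 - q.1) + l1 (x - q.1))) := by positivity
    calc |(if q.1 μ % (N : ℤ) = (N : ℤ) - 1 then (1 : ℝ) else 0)| * (|(if q.2 α % (N : ℤ) = (N : ℤ) - 1 then (1 : ℝ) else 0)| * |S μ q.1 q.2 x (Sum.inl α) f|)
        ≤ 1 * (1 * (Cs * Real.exp (-δ * (l1 (q.2 - q.1) + l1 (x - q.1))))) :=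
          mul_le_mul h1 (mul_le_mul h2 h3 (abs_nonneg _) zero_le_one) (by positivity) zero_le_one
      _ = (Cs * Real.exp (-δ * l1 (x - q.1))) * Real.exp (-δ * l1 (q.2 - q.1)) := by rw [one_mul, one_mul, mul_add, Real.exp_add]; ring
  have hin : ∀ v : Site (d + 1), HasSum (fun y : Site (d + 1) => (Cs * Real.exp (-δ * l1 (x - v))) * Real.exp (-δ * l1 (y - v)))
      ((Cs * Real.exp (-δ * l1 (x - v))) * Zl (d + 1) δ) := by
    intro v
    have h := (summable_exp_shift' hδ v).hasSum
    rw [tsum_exp_shift' v] at h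
    exact h.mul_left _
  have hout : Summable fun v : Site (d + 1) => (Cs * Real.exp (-δ * l1 (x - v))) * Zl (d + 1) δ :=
    ((summable_exp_shift hδ x).mul_left Cs).mul_right _
  have hM0 : Summable fun q : Site (d + 1) × Site (d + 1) => (Cs * Real.exp (-δ * l1 (x - q.1))) * Real.exp (-δ * l1 (q.2 - q.1)) := by
    refine (summable_prod_of_nonneg fun q => by positivity).2 ⟨fun v => (hin v).summable, ?_⟩
    exact hout.congr fun v => ((hin v).tsum_eq).symm
  have hFs : Summable F := Summable.of_norm_bounded hM0 fun q => by rw [Real.norm_eq_abs]; exact hFle q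
  have hcomm : (∑' v : Site (d + 1), ∑' y : Site (d + 1), F (v, y)) = ∑' y : Site (d + 1), ∑' v : Site (d + 1), F (v, y) :=
    (Summable.tsum_comm (f := fun v y => F (v, y)) hFs).symm
  -- left side = `Σ'_v Σ'_y F`
  have hL : (∑' v : Site (d + 1), (if v μ % (N : ℤ) = (N : ℤ) - 1 then (1 : ℝ) else 0) *
        ∑' y : Site (d + 1), (if y α % (N : ℤ) = (N : ℤ) - 1 then (1 : ℝ) else 0) * S μ v y x (Sum.inl α) f) =
      ∑' v : Site (d + 1), ∑' y : Site (d + 1), F (v, y) := by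
    refine tsum_congr fun v => ?_
    rw [← tsum_mul_left]
  -- right side = `Σ'_y Σ'_v F`
  have hR : (∑' y : Site (d + 1), (if y α % (N : ℤ) = (N : ℤ) - 1 then (1 : ℝ) else 0) *
        ∑' v : Site (d + 1), (if v μ % (N : ℤ) = (N : ℤ) - 1 then S μ v y x (Sum.inl α) f else 0)) =
      ∑' y : Site (d + 1), ∑' v : Site (d + 1), F (v, y) := by
    refine tsum_congr fun y => ?_
    rw [← tsum_mul_left]
    refine tsum_congr fun v => ?_
    rw [hF]
    dsimp only
    split_ifs <;> ring
  rw [hL, hR, hcomm]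

end Summit.QuantumFields.BalabanUV.Beta.GAN24.FaceWordCurrentsDeep

end
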